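import Summits.AtomisticToContinuum.Crystallization.Theorems.ExcessDecayLiouvilleCaccioppoliLocalWeights
import Summits.AtomisticToContinuum.Crystallization.Theorems.ExcessDecayLiouvilleLevelMasses

/-!
# Route `ExcessDecayLiouville`: the far flux data of the nonlinear estimates (nonlinear half, VIII)

Harmonic-replacement architecture for item `ExcessDecay` (stmt-AtomisticToContinuum-9334), nonlinear half.
The decay-aware far hypotheses of `gradient_mass_le` / `nnForm_correction_le'` ask for a bound of the double
far sum `Σ_{p ∈ SR ∩ B_R(c₀)} Σ_{q ∈ SR, dist p q > L} (dist p q)⁻⁸ ‖vt q‖²` of the form `Θ₀/L⁵ + Θ₁`.  Swapping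
the sums (`far_flux_sq_le`): the sites `q` of `B_{2b}(c₀)` (`R ≤ b`) see at most the far lattice sum
`F₈(L) = 1024/((23/25)³L⁵)`, the sites beyond `2b` see at most `32b³` points of `B_R`, each at distance
`≥ dist q c₀ / 2`:

`ΣΣ ≤ F₈(L) Σ_{SR ∩ B_{2b}} ‖vt‖² + 8192 b³ Σ_{SR ∖ B_{2b}} (dist q c₀)⁻⁸ ‖vt q‖²`.

All `[folklore]`; helper lemmas, nothing here closes an item.
-/

noncomputable section

namespace Summit.AtomisticToContinuum.Crystallization.Theorems.ExcessDecayLiouville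

open scoped BigOperators Topology Classical
open Literature.MathematicalPhysics.StatisticalMechanics
open Summit.AtomisticToContinuum.Crystallization.Theorems.PhononStabilityNegative

section

variable {t : Fin 2 → (EuclideanSpace ℝ (Fin 3))} {A : (EuclideanSpace ℝ (Fin 3)) →L[ℝ] (EuclideanSpace ℝ (Fin 3))}

/-- **The double far sum, swapped and bounded** (see the module docstring). [folklore] -/
theorem far_flux_sq_le (hA : Adm₀ A) (hI : Inner₀ t A) (vt : (EuclideanSpace ℝ (Fin 3)) → (EuclideanSpace ℝ (Fin 3)))
    (SR : Finset (EuclideanSpace ℝ (Fin 3))) (hSRS : ∀ x ∈ SR, x ∈ Sites₀ t A)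
    (c₀ : EuclideanSpace ℝ (Fin 3)) {b R L : ℝ} (hb : 1 ≤ b) (hRb : R ≤ b) (hL : 1 ≤ L) :
    ∑ p ∈ SR.filter (fun p => dist p c₀ ≤ R),
      ∑ q ∈ (SR.erase p).filter (fun q => ¬ dist p q ≤ L), (dist p q)⁻¹ ^ 8 * ‖vt q‖ ^ 2 ≤
      (1024 / ((23 / 25 : ℝ) ^ 3 * L ^ 5)) * (∑ q ∈ SR.filter (fun q => dist q c₀ ≤ 2 * b), ‖vt q‖ ^ 2) +
      8192 * b ^ 3 * ∑ q ∈ SR.filter (fun q => ¬ dist q c₀ ≤ 2 * b), (dist q c₀)⁻¹ ^ 8 * ‖vt q‖ ^ 2 := by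
  classical
  have hL0 : 23 / 25 ≤ L := by linarith
  -- (1) drop the filters into indicators and swap the sums
  have h1 : ∑ p ∈ SR.filter (fun p => dist p c₀ ≤ R),
      ∑ q ∈ (SR.erase p).filter (fun q => ¬ dist p q ≤ L), (dist p q)⁻¹ ^ 8 * ‖vt q‖ ^ 2 ≤
      ∑ q ∈ SR, ‖vt q‖ ^ 2 * ∑ p ∈ SR.filter (fun p => dist p c₀ ≤ R),
        (if L < dist p q then (dist p q)⁻¹ ^ 8 else 0) := by
    calc _ ≤ ∑ p ∈ SR.filter (fun p => dist p c₀ ≤ R), ∑ q ∈ SR,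
          (if L < dist p q then (dist p q)⁻¹ ^ 8 else 0) * ‖vt q‖ ^ 2 := by
          refine Finset.sum_le_sum fun p _ => ?_
          rw [Finset.sum_filter]
          refine (Finset.sum_le_sum_of_subset_of_nonneg (Finset.erase_subset p SR) fun q _ _ => ?_).trans
            (Finset.sum_le_sum fun q _ => ?_)
          · positivity
          · by_cases h : ¬ dist p q ≤ L
            · rw [if_pos h, if_pos (lt_of_not_ge h)]
            · rw [if_neg h]; positivity
      _ = ∑ q ∈ SR, ∑ p ∈ SR.filter (fun p => dist p c₀ ≤ R),
          (if L < dist p q then (dist p q)⁻¹ ^ 8 else 0) * ‖vt q‖ ^ 2 := Finset.sum_comm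
      _ = _ := by
          refine Finset.sum_congr rfl fun q _ => ?_
          rw [Finset.mul_sum]
          exact Finset.sum_congr rfl fun p _ => mul_comm _ _
  refine h1.trans ?_
  -- (2) the weight of each column
  have hmemP : ∀ p ∈ SR.filter (fun p => dist p c₀ ≤ R), p ∈ Sites₀ t A ∧ dist p c₀ ≤ R := fun p hp => by
    rw [Finset.mem_filter] at hp; exact ⟨hSRS p hp.1, hp.2⟩
  have hcard : ((SR.filter (fun p => dist p c₀ ≤ R)).card : ℝ) ≤ 32 * b ^ 3 :=
    card_ball_sites_le hA hI c₀ hb _ fun p hp => ⟨(hmemP p hp).1, (hmemP p hp).2.trans hRb⟩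
  have hw_near : ∀ q ∈ SR, ∑ p ∈ SR.filter (fun p => dist p c₀ ≤ R),
      (if L < dist p q then (dist p q)⁻¹ ^ 8 else 0) ≤ 1024 / ((23 / 25 : ℝ) ^ 3 * L ^ 5) := by
    intro q hq
    obtain ⟨hs, hle⟩ := summable_far_inv_pow_eight_sites hA hI q hL0
    refine le_trans ?_ hle
    have hmem : ∀ p ∈ SR.filter (fun p => dist p c₀ ≤ R), p ∈ Sites₀ t A := fun p hp => (hmemP p hp).1
    rw [← Finset.sum_subtype_of_mem (f := fun p => (if L < dist p q then (dist p q)⁻¹ ^ 8 else 0)) hmem]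
    exact hs.sum_le_tsum _ fun p _ => by positivity
  have hw_far : ∀ q ∈ SR, ¬ dist q c₀ ≤ 2 * b → ∑ p ∈ SR.filter (fun p => dist p c₀ ≤ R),
      (if L < dist p q then (dist p q)⁻¹ ^ 8 else 0) ≤ 8192 * b ^ 3 * (dist q c₀)⁻¹ ^ 8 := by
    intro q _ hq
    have hq' : 2 * b < dist q c₀ := lt_of_not_ge hq
    have hq0 : 0 < dist q c₀ := by linarith
    have hterm : ∀ p ∈ SR.filter (fun p => dist p c₀ ≤ R),
        (if L < dist p q then (dist p q)⁻¹ ^ 8 else 0) ≤ 256 * (dist q c₀)⁻¹ ^ 8 := by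
      intro p hp
      have hpR := (hmemP p hp).2
      have hdpq : dist q c₀ / 2 ≤ dist p q := by
        have := dist_triangle q p c₀
        rw [dist_comm q p] at this
        linarith
      have hd0 : 0 < dist q c₀ / 2 := by linarith
      split_ifs
      · calc (dist p q)⁻¹ ^ 8 ≤ (dist q c₀ / 2)⁻¹ ^ 8 :=
              pow_le_pow_left₀ (by positivity) ((inv_le_inv₀ (by linarith) hd0).2 hdpq) 8
          _ = 256 * (dist q c₀)⁻¹ ^ 8 := by rw [div_eq_mul_inv, mul_inv, inv_inv, mul_pow, inv_pow]; ring
      · positivity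
    calc _ ≤ ∑ p ∈ SR.filter (fun p => dist p c₀ ≤ R), 256 * (dist q c₀)⁻¹ ^ 8 := Finset.sum_le_sum hterm
      _ = (SR.filter (fun p => dist p c₀ ≤ R)).card * (256 * (dist q c₀)⁻¹ ^ 8) := by
          rw [Finset.sum_const, nsmul_eq_mul]
      _ ≤ 32 * b ^ 3 * (256 * (dist q c₀)⁻¹ ^ 8) := mul_le_mul_of_nonneg_right hcard (by positivity)
      _ = 8192 * b ^ 3 * (dist q c₀)⁻¹ ^ 8 := by ring
  -- (3) split the columns at radius 2b
  rw [← Finset.sum_filter_add_sum_filter_not SR (fun q => dist q c₀ ≤ 2 * b), Finset.mul_sum, Finset.mul_sum]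
  refine add_le_add (Finset.sum_le_sum fun q hq => ?_) (Finset.sum_le_sum fun q hq => ?_)
  · rw [Finset.mem_filter] at hq
    calc ‖vt q‖ ^ 2 * _ ≤ ‖vt q‖ ^ 2 * (1024 / ((23 / 25 : ℝ) ^ 3 * L ^ 5)) :=
          mul_le_mul_of_nonneg_left (hw_near q hq.1) (sq_nonneg _)
      _ = _ := mul_comm _ _
  · rw [Finset.mem_filter] at hq
    calc ‖vt q‖ ^ 2 * _ ≤ ‖vt q‖ ^ 2 * (8192 * b ^ 3 * (dist q c₀)⁻¹ ^ 8) :=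
          mul_le_mul_of_nonneg_left (hw_far q hq.1 hq.2) (sq_nonneg _)
      _ = _ := by ring

end

end Summit.AtomisticToContinuum.Crystallization.Theorems.ExcessDecayLiouville

end
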